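import Summits.BirchSwinnertonDyer.BirchSwinnertonDyer.Theorems.GenusKolyvaginAtTwoOffCutResidualAtTwoRSocleSelectionRealVisibleFrame
import Literature.NumberTheory.EllipticCurves.SelmerProofs
import HarnessLib

/-!
# Route `GenusKolyvaginAtTwo`, residual `OffCutResidualAtTwoR` (stmt-BirchSwinnertonDyer-31767), LINE 27 «socle_selection» STUB S2, conjunct (HL) —
# THE `(1, −1)`-SPLITTING OF `E[2^k]` UNDER AN INVOLUTION FIXING `E[2]`: `E[2^k] = ℤP + ℤQ` with `cP = P`, `cQ = −Q`, as soon as `c ≠ 1` and `c ≠ −1`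
# on `E[2^k]` (the hypothesis `(P, Q)` of `…RealVisibleFrame` / `…RealVisibleRealPlace`, from `c² = 1`, `c|E[2] = id` and halving in `E(K̄)`)

Seat `bsd-line-gk2-p4` g30 (cell `bsd-f1-sign2`), WIDTH-5 attach on route `GenusKolyvaginAtTwo` rev 59; sequel of `…SocleSelectionRealVisibleFrame`.
`--supports stmt-BirchSwinnertonDyer-31767 --as helper`.  THEOREMS ONLY (no definition, no named fact, no `sorry`); standard axioms.
**BSD is NOT proved by this file; `OffCutResidualAtTwoR` is NOT proved; LINE 27's stub S2 is NOT closed by this file alone.**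

WHAT.  `E = W/K` elliptic over a field of characteristic `0`, `k = j + 1 ≥ 1`, `c ∈ Γ_K` with `c · c = 1` fixing every point of `E[2]` (for a complex
conjugation: `Δ > 0`).
* §1 `exists_add_eq_of_involution` — **every `R ∈ E[2^k]` is `P₁ + Q₁` with `P₁, Q₁ ∈ E[2^k]`, `cP₁ = P₁`, `cQ₁ = −Q₁`**: halve `R = 2R'` in the
  divisible group `E(K̄)` (`zsmul_geomPoints_surjective_of_charZero`) and put `P₁ = R' + cR'`, `Q₁ = R' − cR'` (`2^k P₁ = T + cT = 2T = 0` for the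
  `2`-torsion point `T = 2^k R'`, fixed by `c`).
* §2 ★ `exists_split_of_involution` — if moreover `c ≠ 1` and `c ≠ −1` on `E[2^k]`, there are **`P, Q ∈ E[2^k]` with `cP = P`, `cQ = −Q` and
  `E[2^k] = ℤP + ℤQ`**: in a frame `e : E[2^k] ≃ (ℤ/2^k)²` split the two basis vectors, `eᵢ = Pᵢ + Qᵢ`; then
  `1 = det(e₀, e₁) = det(P₀,P₁) + det(P₀,Q₁) + det(Q₀,P₁) + det(Q₀,Q₁)`, a sum of non-units of `ℤ/2^k` is a non-unit, a unit `det(P₀,P₁)` would make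
  `c = 1` and a unit `det(Q₀,Q₁)` would make `c = −1`; the remaining unit determinant gives the basis (`Matrix.isUnit_iff_isUnit_det`,
  `Matrix.mulVec_surjective_iff_isUnit`).
With `…RealVisibleRealPlace` (sequel `…RealVisibleInvolution`): a phantom class of `H¹(K, E[2^k])` in the strict local kernel at a real place whose
complex conjugation fixes `E[2]` and acts on `E[2^k]` neither as `1` nor as `−1` is ZERO.  For `K = ℚ`, `Δ > 0`, `k ≥ 2` the two non-degeneracy clauses
are «`E(ℝ)` has a point of order `4`» and «an egg `2`-torsion point is not halvable over `ℝ`» — the remaining archimedean sequel.  BSD is NOT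
proved by any of this.

References: [LawsonWuthrich2016] §7.1; [SilvermanAEC2009] III.6.4 (b), VIII.§2; [Kramer1981] §2 Prop. 6; [SerreGaloisCohomology1997] II.§6.1.
-/

set_option autoImplicit false
set_option linter.dupNamespace false -- `Summit.<P>.<Sub>` repeats `BirchSwinnertonDyer` (D-0017)

noncomputable section

open scoped Classical MatrixGroups

namespace Summit.BirchSwinnertonDyer.BirchSwinnertonDyer.Theorems.GenusExact.PlusDescent.SocleSelection.RealVisible

open WeierstrassCurve Field Matrix Literature.NumberTheory.EllipticCurves Literature.NumberTheory.GaloisRepresentations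
open Literature.NumberTheory.EllipticCurves.LawsonWuthrich2016

universe u

section Split

variable {K : Type u} [Field K] [CharZero K] (W : WeierstrassCurve K) [W.IsElliptic] (j : ℕ)

/-! ## §1 Every `2^k`-torsion point is a sum of a `c`-fixed and a `c`-anti-fixed one -/

omit [W.IsElliptic] in
/-- **`R = P₁ + Q₁` with `cP₁ = P₁`, `cQ₁ = −Q₁`** for every `R ∈ E[2^k]`, when `c · c = 1` and `c` fixes `E[2]` pointwise: halve `R = 2R'` in `E(K̄)`
and take `P₁ = R' + cR'`, `Q₁ = R' − cR'`. [cite: SilvermanAEC2009, VIII.§2] [cite: LawsonWuthrich2016, §7.1] -/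
theorem exists_add_eq_of_involution {c : absoluteGaloisGroup K} (hc2 : c * c = 1)
    (hfix : ∀ T : geomPoints W, (2 : ℤ) • T = 0 → c • T = T) (R : geomTorsion W ((2 ^ (j + 1) : ℕ) : ℤ)) :
    ∃ P₁ Q₁ : geomTorsion W ((2 ^ (j + 1) : ℕ) : ℤ), c • P₁ = P₁ ∧ c • Q₁ = -Q₁ ∧ R = P₁ + Q₁ := by
  obtain ⟨R', hR'⟩ := W.zsmul_geomPoints_surjective_of_charZero (n := 2) two_ne_zero (R : geomPoints W)
  simp only at hR'
  -- the `2`-torsion point `T = 2^k R'` is fixed by `c`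
  have hR : (((2 ^ (j + 1) : ℕ) : ℤ)) • (R : geomPoints W) = 0 := (mem_geomTorsion_iff W _ _).mp R.2
  have hT2 : (2 : ℤ) • ((((2 ^ (j + 1) : ℕ) : ℤ)) • R') = 0 := by
    rw [smul_comm, hR', hR]
  have hT : c • ((((2 ^ (j + 1) : ℕ) : ℤ)) • R') = (((2 ^ (j + 1) : ℕ) : ℤ)) • R' := hfix _ hT2
  have hcc : c • (c • R') = R' := by rw [← mul_smul, hc2, one_smul]
  -- membership of `P₁`, `Q₁` in `E[2^k]`
  have hP₁mem : R' + c • R' ∈ geomTorsion W ((2 ^ (j + 1) : ℕ) : ℤ) := by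
    rw [mem_geomTorsion_iff, smul_add, smul_comm _ c, hT, ← two_zsmul, hT2]
  have hQ₁mem : R' - c • R' ∈ geomTorsion W ((2 ^ (j + 1) : ℕ) : ℤ) := by
    rw [mem_geomTorsion_iff, smul_sub, smul_comm _ c, hT, sub_self]
  refine ⟨⟨R' + c • R', hP₁mem⟩, ⟨R' - c • R', hQ₁mem⟩, Subtype.ext ?_, Subtype.ext ?_, Subtype.ext ?_⟩
  · change c • (R' + c • R') = R' + c • R'
    rw [smul_add, hcc, add_comm]
  · change c • (R' - c • R') = -(R' - c • R')
    rw [smul_sub, hcc, neg_sub]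
  · change (R : geomPoints W) = (R' + c • R') + (R' - c • R')
    rw [add_add_sub_cancel, ← two_zsmul, hR']

/-! ## §2 ★ The `(1, −1)`-basis -/

omit [CharZero K] [W.IsElliptic] in
/-- In `ℤ/2^k`: a sum of four elements equal to `1` has a unit among its summands (the non-units form the ideal `(2)`). [folklore] -/
theorem isUnit_or_of_add_eq_one {a b c d : ZMod (2 ^ (j + 1))} (h : a + b + c + d = 1) :
    IsUnit a ∨ IsUnit b ∨ IsUnit c ∨ IsUnit d := by
  haveI : NeZero (2 ^ (j + 1)) := ⟨pow_ne_zero _ two_ne_zero⟩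
  -- reduce modulo `2`
  have hdvd : 2 ∣ 2 ^ (j + 1) := dvd_pow_self 2 (Nat.succ_ne_zero j)
  let π : ZMod (2 ^ (j + 1)) →+* ZMod 2 := ZMod.castHom hdvd (ZMod 2)
  -- an element with non-zero image mod `2` is `1 + 2m`, a unit
  have key : ∀ x : ZMod (2 ^ (j + 1)), π x ≠ 0 → IsUnit x := by
    intro x hx
    obtain ⟨m, hm⟩ : ∃ m : ℕ, x.val = 2 * m ∨ x.val = 2 * m + 1 := ⟨x.val / 2, by omega⟩
    have hxv : x = (x.val : ZMod (2 ^ (j + 1))) := (ZMod.natCast_zmod_val x).symm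
    rcases hm with hm | hm
    · exfalso; apply hx
      rw [hxv, map_natCast, hm, Nat.cast_mul]
      have h20 : ((2 : ℕ) : ZMod 2) = 0 := by decide
      rw [h20, zero_mul]
    · rw [hxv, hm]
      push_cast
      rw [show (2 : ZMod (2 ^ (j + 1))) * m + 1 = 1 + 2 * m by ring]
      exact isUnit_one_add_two_mul j _
  by_contra hnot
  push Not at hnot
  obtain ⟨ha, hb, hc, hd⟩ := hnot
  have h0 : ∀ x : ZMod (2 ^ (j + 1)), ¬ IsUnit x → π x = 0 := fun x hx ↦ by
    by_contra h'; exact hx (key x h')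
  have hsum := congrArg π h
  rw [map_add, map_add, map_add, h0 a ha, h0 b hb, h0 c hc, h0 d hd, map_one] at hsum
  simp at hsum

/-- ★ **THE `(1, −1)`-BASIS.**  `E/K` elliptic in characteristic `0`, `k = j + 1`; `c ∈ Γ_K` with `c · c = 1` fixing `E[2]` pointwise, acting on `E[2^k]` neither as
the identity (`∃ R, cR ≠ R`) nor as `−1` (`∃ R, cR ≠ −R`).  Then there are `P, Q ∈ E[2^k]` with `cP = P`, `cQ = −Q` and `E[2^k] = ℤP + ℤQ` — the
hypothesis of `…RealVisibleFrame.not_mem_subgroupResKer_zpowers_of_split`.  (In a frame, `1 = det(e₀,e₁)` is the sum of the four cross determinants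
of the splittings `eᵢ = Pᵢ + Qᵢ`; one is a unit; the two «pure» ones are excluded by the non-degeneracy clauses.)
[cite: LawsonWuthrich2016, §7.1] [cite: SilvermanAEC2009, III.6.4 (b), VIII.§2] -/
theorem exists_split_of_involution (h2 : (2 : K) ≠ 0) {c : absoluteGaloisGroup K} (hc2 : c * c = 1)
    (hfix : ∀ T : geomPoints W, (2 : ℤ) • T = 0 → c • T = T)
    (hne : ∃ R : geomTorsion W ((2 ^ (j + 1) : ℕ) : ℤ), c • R ≠ R)
    (hne' : ∃ R : geomTorsion W ((2 ^ (j + 1) : ℕ) : ℤ), c • R ≠ -R) :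
    ∃ P Q : geomTorsion W ((2 ^ (j + 1) : ℕ) : ℤ), c • P = P ∧ c • Q = -Q ∧
      ∀ R : geomTorsion W ((2 ^ (j + 1) : ℕ) : ℤ), ∃ a b : ℤ, R = a • P + b • Q := by
  haveI : Fact (Nat.Prime 2) := ⟨Nat.prime_two⟩
  haveI : NeZero (2 ^ (j + 1)) := ⟨pow_ne_zero _ two_ne_zero⟩
  obtain ⟨e⟩ := nonempty_addEquiv_geomTorsion W 2 (j + 1) (Nat.succ_pos j) h2
  -- split the two basis vectors
  obtain ⟨P₀, Q₀, hP₀, hQ₀, h₀⟩ := exists_add_eq_of_involution W j hc2 hfix (e.symm (Pi.single 0 1))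
  obtain ⟨P₁, Q₁, hP₁, hQ₁, h₁⟩ := exists_add_eq_of_involution W j hc2 hfix (e.symm (Pi.single 1 1))
  -- `2 × 2` determinants of pairs of coordinate vectors
  have hdet : ∀ v w : Fin 2 → ZMod (2 ^ (j + 1)),
      (!![v 0, w 0; v 1, w 1] : Matrix (Fin 2) (Fin 2) (ZMod (2 ^ (j + 1)))).det = v 0 * w 1 - w 0 * v 1 := fun v w ↦ by
    rw [Matrix.det_fin_two_of]
  -- the basis identity `1 = Σ` of the four cross determinants
  have hE₀ : e P₀ + e Q₀ = Pi.single 0 1 := by rw [← map_add, ← h₀, e.apply_symm_apply]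
  have hE₁ : e P₁ + e Q₁ = Pi.single 1 1 := by rw [← map_add, ← h₁, e.apply_symm_apply]
  have hsum : (e P₀ 0 * e P₁ 1 - e P₁ 0 * e P₀ 1) + (e P₀ 0 * e Q₁ 1 - e Q₁ 0 * e P₀ 1) +
      (e Q₀ 0 * e P₁ 1 - e P₁ 0 * e Q₀ 1) + (e Q₀ 0 * e Q₁ 1 - e Q₁ 0 * e Q₀ 1) = 1 := by
    have a0 : e P₀ 0 + e Q₀ 0 = 1 := by simpa using congr_fun hE₀ 0
    have a1 : e P₀ 1 + e Q₀ 1 = 0 := by simpa using congr_fun hE₀ 1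
    have b0 : e P₁ 0 + e Q₁ 0 = 0 := by simpa using congr_fun hE₁ 0
    have b1 : e P₁ 1 + e Q₁ 1 = 1 := by simpa using congr_fun hE₁ 1
    linear_combination (e P₁ 1 + e Q₁ 1) * a0 + b1 - (e P₁ 0 + e Q₁ 0) * a1 - 0 * b0
  -- a spanning pair from a unit determinant
  have span : ∀ P Q : geomTorsion W ((2 ^ (j + 1) : ℕ) : ℤ), IsUnit (e P 0 * e Q 1 - e Q 0 * e P 1) →
      ∀ R : geomTorsion W ((2 ^ (j + 1) : ℕ) : ℤ), ∃ a b : ℤ, R = a • P + b • Q := by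
    intro P Q hu R
    set B : Matrix (Fin 2) (Fin 2) (ZMod (2 ^ (j + 1))) := !![e P 0, e Q 0; e P 1, e Q 1] with hB
    have hBu : IsUnit B := (Matrix.isUnit_iff_isUnit_det B).2 (by rw [hB, hdet]; exact hu)
    obtain ⟨v, hv⟩ := (Matrix.mulVec_surjective_iff_isUnit.2 hBu) (e R)
    have hBmul : B *ᵥ v = v 0 • e P + v 1 • e Q := by
      funext i; fin_cases i <;> simp [hB, Matrix.mulVec, dotProduct, Fin.sum_univ_two, mul_comm]
    refine ⟨((v 0).val : ℤ), ((v 1).val : ℤ), e.injective ?_⟩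
    rw [map_add, map_zsmul, map_zsmul, ← hv, hBmul]
    funext i
    simp only [Pi.add_apply, Pi.smul_apply]
    simp only [smul_eq_mul, zsmul_eq_mul, Int.cast_natCast, ZMod.natCast_zmod_val]
  -- `c` acts trivially / as `−1` on a span of fixed / anti-fixed points
  have fixed_span : ∀ P Q : geomTorsion W ((2 ^ (j + 1) : ℕ) : ℤ), c • P = P → c • Q = Q →
      (∀ R : geomTorsion W ((2 ^ (j + 1) : ℕ) : ℤ), ∃ a b : ℤ, R = a • P + b • Q) → False := by
    intro P Q hP hQ hspan
    obtain ⟨R, hR⟩ := hne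
    obtain ⟨a, b, rfl⟩ := hspan R
    exact hR (by rw [smul_add, smul_comm c a P, smul_comm c b Q, hP, hQ])
  have anti_span : ∀ P Q : geomTorsion W ((2 ^ (j + 1) : ℕ) : ℤ), c • P = -P → c • Q = -Q →
      (∀ R : geomTorsion W ((2 ^ (j + 1) : ℕ) : ℤ), ∃ a b : ℤ, R = a • P + b • Q) → False := by
    intro P Q hP hQ hspan
    obtain ⟨R, hR⟩ := hne'
    obtain ⟨a, b, rfl⟩ := hspan R
    exact hR (by rw [smul_add, smul_comm c a P, smul_comm c b Q, hP, hQ, smul_neg, smul_neg, neg_add])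
  -- case analysis on the unit summand
  rcases isUnit_or_of_add_eq_one j hsum with hu | hu | hu | hu
  · exact (fixed_span P₀ P₁ hP₀ hP₁ (span P₀ P₁ hu)).elim
  · exact ⟨P₀, Q₁, hP₀, hQ₁, span P₀ Q₁ hu⟩
  · refine ⟨P₁, Q₀, hP₁, hQ₀, fun R ↦ ?_⟩
    obtain ⟨a, b, hab⟩ := span Q₀ P₁ hu R
    exact ⟨b, a, hab.trans (add_comm _ _)⟩
  · exact (anti_span Q₀ Q₁ hQ₀ hQ₁ (span Q₀ Q₁ hu)).elim

end Split

end Summit.BirchSwinnertonDyer.BirchSwinnertonDyer.Theorems.GenusExact.PlusDescent.SocleSelection.RealVisible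

end
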